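import Summits.Ventures.LatticeQCDFlow.Scaling.ReplicaExchangeFlowSwap
import Summits.Ventures.LatticeQCDFlow.Scaling.ReplicaExchangeBareAcceptance

/-!
HONEST FRAMING: exact (Metropolis-corrected) sampling algorithms for lattice gauge theory; figures
of merit are autocorrelation/cost numbers at stated couplings and volumes; no continuum-physics
claim.

# ReplicaExchangeFlowSwapTransport — PERFECT TRANSPORT MAPS MAKE THE FLOW SWAP REJECTION-FREE: IF `φ_j♯μ_j = μ_{j+1}`
# THEN `π̃(flowSwapAt φ j x) = π̃(x)`, THE METROPOLIS FLOW SWAP EQUALS ITS PROPOSAL, AND THE STATIONARY ACCEPTANCE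
# OF EVERY PAIR IS ONE — YET (`Scaling/ReplicaExchangeFlowSwapDiffusive`) THE DIFFUSIVE CEILING IS UNCHANGED
# (lean-2 GEN-19, ours)

Venture-side (OURS).  Cell `lqcd-flow` (pub-lqcd), unit `pub-lqcd-lean-2-g19`, 2026-08-25.  Chapter F, in the setting
of `Scaling/ReplicaExchangeFlowSwap` (`flowSwapAt`, `ptFlowProposal`, `ptFlowSwap`, `ptFlowSampler`).  A map `φ_j`
TRANSPORTS level `j` to level `j+1` when `μ_{j+1}(φ_j u) = μ_j(u)` for every configuration `u` (on a finite space: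
`φ_j♯μ_j = μ_{j+1}`; the ideal a trained flow between neighbouring couplings aims at).

## What is proved

* **`tensorFun_flowSwapAt_mul`** — for every bijection: `π̃(x^{(j)})·μ_j(x_j)μ_{j+1}(x_{j+1}) =
  π̃(x)·μ_j(φ_j⁻¹x_{j+1})μ_{j+1}(φ_j x_j)`;
* **`tensorFun_flowSwapAt_of_transport`** — perfect transport ⇒ `π̃(x^{(j)}) = π̃(x)`;
* **`ptFlowSwap_eq_proposal_of_transport`** — perfect transports at every pair ⇒ `ptFlowSwap μ φ x y =
  ptFlowProposal φ x y` for `y ≠ x` (every proposed flow swap is accepted);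
* **`flowSwap_acceptance_eq_one_of_transport`** — `Σ_x min{π̃(x), π̃(x^{(j)})} = 1` for every pair `j`.

Reading (no numerics implied): this is the regime flows are trained for; `Scaling/ReplicaExchangeFlowSwapDiffusive`
shows that even then, if the maps preserve topological sectors, the gap of the exact sampler over sector-frozen cold
replicas is `≤ 3td/(v·K(K+1)(2K+1))` — the maps remove the rejections, not the ladder.  NOT CLAIMED: existence or
construction of transport maps; anything measured.  Literature grade (cell rule): ELEMENTARY, NEW TYPING; nothing
cited as a fact; no new bib keys.
-/

noncomputable section

open Finset Function
open Literature.Probability.MarkovChains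

namespace Summit.Ventures.LatticeQCDFlow.Scaling

variable {S : Type*} [Fintype S] [DecidableEq S] {K : ℕ} {μ : Fin (K + 1) → S → ℝ} {φ : Fin K → Equiv.Perm S}

omit [Fintype S] [DecidableEq S] in
/-- **The flow-swapped weight:** `π̃(x^{(j)})·μ_j(x_j)μ_{j+1}(x_{j+1}) = π̃(x)·μ_j(φ_j⁻¹x_{j+1})μ_{j+1}(φ_j x_j)`.
[ours] -/
theorem tensorFun_flowSwapAt_mul (μ : Fin (K + 1) → S → ℝ) (φ : Fin K → Equiv.Perm S) (x : Fin (K + 1) → S)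
    (j : Fin K) :
    tensorFun μ (flowSwapAt φ j x) * (μ j.castSucc (x j.castSucc) * μ j.succ (x j.succ))
      = tensorFun μ x * (μ j.castSucc ((φ j).symm (x j.succ)) * μ j.succ (φ j (x j.castSucc))) := by
  have hne : j.castSucc ≠ j.succ := ne_of_lt Fin.castSucc_lt_succ
  unfold tensorFun
  rw [prod_levels_split_two (fun k => μ k (flowSwapAt φ j x k)) hne, prod_levels_split_two (fun k => μ k (x k)) hne]
  have hrest : ∏ k ∈ (univ.erase j.castSucc).erase j.succ, μ k (flowSwapAt φ j x k)
      = ∏ k ∈ (univ.erase j.castSucc).erase j.succ, μ k (x k) := by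
    refine prod_congr rfl fun k hk => ?_
    have h2 : k ≠ j.succ := Finset.ne_of_mem_erase hk
    have h1 : k ≠ j.castSucc := Finset.ne_of_mem_erase (Finset.mem_of_mem_erase hk)
    rw [flowSwapAt_of_ne φ j x h1 h2]
  rw [hrest]
  simp only [flowSwapAt_castSucc, flowSwapAt_succ]
  ring

omit [Fintype S] [DecidableEq S] in
/-- **Perfect transport preserves the product weight:** `μ_{j+1}(φ_j u) = μ_j(u)` for all `u` ⇒
`π̃(flowSwapAt φ j x) = π̃(x)` (positive level laws). [ours] -/
theorem tensorFun_flowSwapAt_of_transport (hμ : ∀ k u, 0 < μ k u) {j : Fin K}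
    (hφ : ∀ u, μ j.succ (φ j u) = μ j.castSucc u) (x : Fin (K + 1) → S) :
    tensorFun μ (flowSwapAt φ j x) = tensorFun μ x := by
  have h := tensorFun_flowSwapAt_mul μ φ x j
  have h1 : μ j.castSucc ((φ j).symm (x j.succ)) = μ j.succ (x j.succ) := by
    rw [← hφ ((φ j).symm (x j.succ)), Equiv.apply_symm_apply]
  rw [h1, hφ (x j.castSucc), mul_comm (μ j.succ (x j.succ)) (μ j.castSucc (x j.castSucc))] at h
  exact mul_right_cancel₀ (mul_pos (hμ _ _) (hμ _ _)).ne' h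

omit [Fintype S] in
/-- A proposed state is a flow swap of the current one. [ours] -/
theorem exists_flowSwapAt_of_ptFlowProposal_ne_zero {x y : Fin (K + 1) → S} (h : ptFlowProposal φ x y ≠ 0) :
    ∃ j : Fin K, y = flowSwapAt φ j x := by
  by_contra hne
  push Not at hne
  apply h
  unfold ptFlowProposal
  exact Finset.sum_eq_zero fun j _ => if_neg (hne j)

/-- **PERFECT TRANSPORTS MAKE THE FLOW SWAP REJECTION-FREE:** if every `φ_j` transports `μ_j` to `μ_{j+1}`, the
Metropolis flow-swap move coincides with its proposal off the diagonal. [ours] -/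
theorem ptFlowSwap_eq_proposal_of_transport (hμ : ∀ k u, 0 < μ k u)
    (hφ : ∀ (j : Fin K) (u : S), μ j.succ (φ j u) = μ j.castSucc u) {x y : Fin (K + 1) → S} (hyx : y ≠ x) :
    ptFlowSwap μ φ x y = ptFlowProposal φ x y := by
  unfold ptFlowSwap
  rw [mhKernel_of_ne hyx]
  unfold mhRate
  by_cases hT : ptFlowProposal φ x y = 0
  · rw [hT, ptFlowProposal_symm φ y x, hT]; simp
  · obtain ⟨j, hj⟩ := exists_flowSwapAt_of_ptFlowProposal_ne_zero hT
    have hπ : tensorFun μ y = tensorFun μ x := by rw [hj]; exact tensorFun_flowSwapAt_of_transport hμ (hφ j) x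
    have e : tensorFun μ x * ptFlowProposal φ x y / tensorFun μ x = ptFlowProposal φ x y :=
      mul_div_cancel_left₀ _ (tensorFun_pos hμ x).ne'
    rw [hπ, ptFlowProposal_symm φ y x, e, min_self]

omit [DecidableEq S] in
/-- **UNIT STATIONARY ACCEPTANCE:** with a perfect transport at pair `j`, `Σ_x min{π̃(x), π̃(x^{(j)})} = 1`. [ours] -/
theorem flowSwap_acceptance_eq_one_of_transport (hμ : ∀ k u, 0 < μ k u) (hμ1 : ∀ k, ∑ u, μ k u = 1) {j : Fin K}
    (hφ : ∀ u, μ j.succ (φ j u) = μ j.castSucc u) :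
    ∑ x : Fin (K + 1) → S, min (tensorFun μ x) (tensorFun μ (flowSwapAt φ j x)) = 1 := by
  simp_rw [tensorFun_flowSwapAt_of_transport hμ hφ, min_self]
  exact sum_tensorFun_eq_one μ hμ1

end Summit.Ventures.LatticeQCDFlow.Scaling

end
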